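import Summits.AtomisticToContinuum.FouriersLaw.Theorems.PhononMeanFreePathIncoherentBoundedCoherentLandauer
import Literature.MathematicalPhysics.KineticTheory.MomentumHermiteLadder
import Summits.AtomisticToContinuum.FouriersLaw.Theorems.PhononMeanFreePathCoherentDephasingResponseStatics
import Summits.AtomisticToContinuum.FouriersLaw.Theorems.BondHeatUncertaintyLightConeBondHeatGibbsByParts

/-!
# Strict absorption, sub-goal K3 (1/3): the witnessed pointwise coherent bound
# (crux `PhononMeanFreePath.CoherentDephasing`, stmt-AtomisticToContinuum-11810; line `Sketch`, lead c2)

For the pinned anharmonic chain with both Langevin baths at `T`, Gibbs law `μ_T`, constructed kernels `K_s` and a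
compactly supported observable `F`, the tree's Landauer argument (`…IncoherentBoundedCoherentLandauer`) bounds
`⟨p_j, K_sF⟩ = T·E_μ[∂_{p_j}K_sF]` by Jensen. The slack of that step is `T² Var_μ(∂_{p_j}K_sF)`, and for any centred
observable `g` of the POSITIONS `Cov_μ(∂_{p₀}K_sF, g) = (1/T)⟨p₀ g, K_sF⟩` needs no derivative of `g` (Gaussian
integration by parts of `g·K_sF`). This file proves:

* `witness_sq_integral_add_sq_le` — the witnessed Jensen inequality `(∫g²)(∫X)² + (∫gX)² ≤ (∫g²)∫X²` (`∫g = 0`);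
* `witness_integral_snd_mul_eq` — `∫ p_j u dμ_T = T ∫ ∂_{p_j}u dμ_T` under integrability hypotheses only;
* `witness_pointwise` / `sa_witnessPointwise` (registered sub-goal) —
  `(∫g²)·[⟨p₀,K_sF⟩² + ⟨p_{N-1},K_sF⟩²] + ⟨p₀g, K_sF⟩² ≤ (∫g²)T²[‖∂_{p₀}K_sF‖² + ‖∂_{p_{N-1}}K_sF‖²]`.

Continued in `…LandauerWitnessAux2` (time integration, truncation) and `…LandauerWitness` (the registered K3).
No definition, no `sorry`, standard axioms.
-/

noncomputable section

open MeasureTheory ProbabilityTheory Filter Topology Set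
open scoped NNReal ENNReal ContDiff

namespace Summit.AtomisticToContinuum.FouriersLaw.Theorems.CoherentDephasing.StrictAbsorption

open Literature.MathematicalPhysics.KineticTheory.HeatConduction
open Literature.MathematicalPhysics.KineticTheory Literature.Probability.Process OscillatorChain
open Summit.AtomisticToContinuum.FouriersLaw.Theorems.IncoherentBounded
open Summit.AtomisticToContinuum.FouriersLaw.Theorems.SubdiffusiveBondHeat
open Summit.AtomisticToContinuum.FouriersLaw.Cruxes.SuperadditiveResistance.FloatingProbeBypassLaplacian

/-! ## Chain-free pieces -/

/-- **The witnessed Jensen inequality** on a probability space: if `∫ φ = 0` then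
`(∫ φ²)·(∫ X)² + (∫ φ X)² ≤ (∫ φ²)·∫ X²` (write `∫ φ X = ∫ φ (X - ∫X)` and apply Cauchy–Schwarz; the variance of
`X` absorbs the witness term). [folklore] -/
theorem witness_sq_integral_add_sq_le {Ω : Type*} [MeasurableSpace Ω] {κ : Measure Ω} [IsProbabilityMeasure κ]
    {X φ : Ω → ℝ} (hX : Integrable X κ) (hX2 : Integrable (fun z => X z ^ 2) κ)
    (hφ : Integrable φ κ) (hφ2 : Integrable (fun z => φ z ^ 2) κ) (hφX : Integrable (fun z => φ z * X z) κ)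
    (hφ0 : ∫ z, φ z ∂κ = 0) :
    (∫ z, φ z ^ 2 ∂κ) * (∫ z, X z ∂κ) ^ 2 + (∫ z, φ z * X z ∂κ) ^ 2 ≤
      (∫ z, φ z ^ 2 ∂κ) * ∫ z, X z ^ 2 ∂κ := by
  set m := ∫ z, X z ∂κ with hm
  set V := ∫ z, φ z ^ 2 ∂κ with hV
  have hV0 : 0 ≤ V := integral_nonneg fun z => sq_nonneg _
  -- `∫ φ X = ∫ φ (X - m)`
  have hc : ∫ z, φ z * X z ∂κ = ∫ z, φ z * (X z - m) ∂κ := by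
    have h1 : ∫ z, φ z * (X z - m) ∂κ = (∫ z, φ z * X z ∂κ) - m * ∫ z, φ z ∂κ := by
      have e : (fun z => φ z * (X z - m)) = fun z => φ z * X z - m * φ z := by funext z; ring
      rw [e, integral_sub hφX (hφ.const_mul m), integral_const_mul]
    rw [h1, hφ0, mul_zero, sub_zero]
  -- `∫ (X - m)² = ∫ X² - m²`
  have hvar : ∫ z, (X z - m) ^ 2 ∂κ = (∫ z, X z ^ 2 ∂κ) - m ^ 2 := by
    have e : (fun z => (X z - m) ^ 2) = fun z => (X z ^ 2 - 2 * m * X z) + m ^ 2 := by funext z; ring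
    have i1 : Integrable (fun z => X z ^ 2 - 2 * m * X z) κ := hX2.sub (hX.const_mul _)
    have h1 : ∫ z, (X z ^ 2 - 2 * m * X z) + m ^ 2 ∂κ = (∫ z, X z ^ 2 - 2 * m * X z ∂κ) + ∫ _z, m ^ 2 ∂κ :=
      integral_add i1 (integrable_const _)
    have h2 : ∫ z, X z ^ 2 - 2 * m * X z ∂κ = (∫ z, X z ^ 2 ∂κ) - ∫ z, 2 * m * X z ∂κ :=
      integral_sub hX2 (hX.const_mul _)
    rw [e, h1, h2, integral_const_mul, integral_const, probReal_univ, one_smul]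
    ring
  -- Cauchy–Schwarz `(∫ φ (X-m))² ≤ ∫ φ² ∫ (X-m)²`
  have hXm : Integrable (fun z => X z - m) κ := hX.sub (integrable_const m)
  have hXm2 : Integrable (fun z => (X z - m) ^ 2) κ := by
    have e : (fun z => (X z - m) ^ 2) = fun z => X z ^ 2 - 2 * m * X z + m ^ 2 := by funext z; ring
    rw [e]; exact (hX2.sub (hX.const_mul _)).add (integrable_const _)
  have hφXm : Integrable (fun z => φ z * (X z - m)) κ := by
    have e : (fun z => φ z * (X z - m)) = fun z => φ z * X z - m * φ z := by funext z; ring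
    rw [e]; exact hφX.sub (hφ.const_mul m)
  have hcs : (∫ z, φ z * (X z - m) ∂κ) ^ 2 ≤ V * ∫ z, (X z - m) ^ 2 ∂κ := by
    -- quadratic-form argument: `0 ≤ ∫ (t φ - (X-m))²` for all `t`
    have hq : ∀ t : ℝ, 0 ≤ V * t ^ 2 - 2 * (∫ z, φ z * (X z - m) ∂κ) * t + ∫ z, (X z - m) ^ 2 ∂κ := by
      intro t
      have h0 : 0 ≤ ∫ z, (t * φ z - (X z - m)) ^ 2 ∂κ := integral_nonneg fun z => sq_nonneg _
      have e : (fun z => (t * φ z - (X z - m)) ^ 2) =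
          fun z => (t ^ 2 * φ z ^ 2 - 2 * t * (φ z * (X z - m))) + (X z - m) ^ 2 := by funext z; ring
      have i1 : Integrable (fun z => t ^ 2 * φ z ^ 2 - 2 * t * (φ z * (X z - m))) κ :=
        (hφ2.const_mul _).sub (hφXm.const_mul _)
      have h1 : ∫ z, (t ^ 2 * φ z ^ 2 - 2 * t * (φ z * (X z - m))) + (X z - m) ^ 2 ∂κ =
          (∫ z, t ^ 2 * φ z ^ 2 - 2 * t * (φ z * (X z - m)) ∂κ) + ∫ z, (X z - m) ^ 2 ∂κ := integral_add i1 hXm2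
      have h2 : ∫ z, t ^ 2 * φ z ^ 2 - 2 * t * (φ z * (X z - m)) ∂κ =
          (∫ z, t ^ 2 * φ z ^ 2 ∂κ) - ∫ z, 2 * t * (φ z * (X z - m)) ∂κ :=
        integral_sub (hφ2.const_mul _) (hφXm.const_mul _)
      rw [e, h1, h2, integral_const_mul, integral_const_mul] at h0
      rw [hV]; linarith
    set c := ∫ z, φ z * (X z - m) ∂κ with hcdef
    set W := ∫ z, (X z - m) ^ 2 ∂κ with hW
    have hW0 : 0 ≤ W := integral_nonneg fun z => sq_nonneg _
    rcases eq_or_lt_of_le hV0 with hV00 | hVpos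
    · -- `V = 0`: then `c = 0`
      have : c = 0 := by
        by_contra hc0
        have h1 := hq ((W + 1) / (2 * c))
        rw [← hV00] at h1
        have : 2 * c * ((W + 1) / (2 * c)) = W + 1 := by field_simp
        nlinarith
      rw [this, ← hV00]; simp
    · have h1 := hq (c / V)
      have : V * (c / V) ^ 2 - 2 * c * (c / V) + W = W - c ^ 2 / V := by field_simp; ring
      rw [this] at h1
      have h2 : c ^ 2 / V ≤ W := by linarith
      rwa [div_le_iff₀ hVpos, mul_comm] at h2
  rw [hc]
  calc V * m ^ 2 + (∫ z, φ z * (X z - m) ∂κ) ^ 2 ≤ V * m ^ 2 + V * ∫ z, (X z - m) ^ 2 ∂κ := by linarith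
    _ = V * ∫ z, X z ^ 2 ∂κ := by rw [hvar]; ring

/-! ## Gaussian integration by parts without boundedness -/

section Chain

variable {ω₂ lam β γ : ℝ} (hω : 0 < ω₂) (hl : 0 ≤ lam) (hβ : 0 < β) (hγ : 0 < γ) {N : ℕ} (hN : 0 < N)
  {T : ℝ} (hT : 0 < T)
include hω hl hβ hγ hN hT

omit hγ hN in
/-- **Gaussian integration by parts in `p_j` under `μ_T`** for a differentiable `u` with `u`, `p_j u` and `∂_{p_j}u`
all `μ_T`-integrable (no boundedness): `∫ p_j u dμ_T = T ∫ ∂_{p_j} u dμ_T`. (The tree's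
`integral_snd_mul_eq_integral_partialP` with its `L∞` hypothesis replaced by the two integrability facts it was used
for.) [folklore] -/
theorem witness_integral_snd_mul_eq (j : Fin N) {u : PhaseSpace N → ℝ} (hu : Differentiable ℝ u)
    (hu1 : Integrable u ((pinnedChain ω₂ lam β γ).gibbsMeasure N T))
    (hpu : Integrable (fun x => x.2 j * u x) ((pinnedChain ω₂ lam β γ).gibbsMeasure N T))
    (hdu : Integrable (partialP j u) ((pinnedChain ω₂ lam β γ).gibbsMeasure N T)) :
    ∫ x, x.2 j * u x ∂((pinnedChain ω₂ lam β γ).gibbsMeasure N T) =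
      T * ∫ x, partialP j u x ∂((pinnedChain ω₂ lam β γ).gibbsMeasure N T) := by
  set P := pinnedChain ω₂ lam β γ with hP
  have i0 := integrable_mul_gibbsDensity_of_integrable hω hl hβ.le γ N hT hu1
  have i1 := integrable_mul_gibbsDensity_of_integrable hω hl hβ.le γ N hT hpu
  have i2 := integrable_mul_gibbsDensity_of_integrable hω hl hβ.le γ N hT hdu
  haveI := HeatConduction.isAddHaarMeasure_volume_phaseSpace N
  have e := integral_bilinear_hasLineDerivAt_right_eq_neg_left_of_integrable
    (μ := (volume : Measure (PhaseSpace N))) (B := ContinuousLinearMap.mul ℝ ℝ)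
    (f := u) (f' := partialP j u) (g := P.gibbsDensity N T)
    (g' := fun x => -(x.2 j / T) * P.gibbsDensity N T x)
    (v := ((0, Pi.single j 1) : PhaseSpace N)) ?_ ?_ ?_ (fun x _ => hasLineDerivAt_partialP hu j x)
    (fun x _ => P.hasLineDerivAt_gibbsDensity (P.hasLineDerivAt_hamiltonian_unitP N x j))
  · simp only [ContinuousLinearMap.mul_apply'] at e
    have e1 : ∫ x, u x * (-(x.2 j / T) * P.gibbsDensity N T x) =
        -T⁻¹ * ∫ x, x.2 j * u x * P.gibbsDensity N T x := by
      rw [← integral_const_mul]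
      refine integral_congr_ae (ae_of_all _ fun x => ?_)
      simp only
      field_simp
    rw [e1] at e
    have e2 : ∫ x, x.2 j * u x * P.gibbsDensity N T x = T * ∫ x, partialP j u x * P.gibbsDensity N T x := by
      have hTT : T * T⁻¹ = 1 := mul_inv_cancel₀ hT.ne'
      calc ∫ x, x.2 j * u x * P.gibbsDensity N T x
          = -T * (-T⁻¹ * ∫ x, x.2 j * u x * P.gibbsDensity N T x) := by
            rw [← mul_assoc, show -T * -T⁻¹ = T * T⁻¹ by ring, hTT, one_mul]
        _ = -T * -∫ x, partialP j u x * P.gibbsDensity N T x := by rw [e]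
        _ = T * ∫ x, partialP j u x * P.gibbsDensity N T x := by ring
    rw [P.integral_gibbsMeasure, P.integral_gibbsMeasure, e2]
    ring
  · simp only [ContinuousLinearMap.mul_apply']
    exact i2
  · simp only [ContinuousLinearMap.mul_apply']
    have : Integrable (fun x => -T⁻¹ * (x.2 j * u x * P.gibbsDensity N T x)) := i1.const_mul _
    refine this.congr (ae_of_all _ fun x => ?_)
    simp only
    field_simp
  · simp only [ContinuousLinearMap.mul_apply']
    exact i0

omit hγ hN hT in
/-- `1 + H ≤ (1 + H)²` (`H ≥ 0`). [folklore] -/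
theorem witness_one_add_le_sq (y : PhaseSpace N) :
    1 + (pinnedChain ω₂ lam β γ).hamiltonian N y ≤ (1 + (pinnedChain ω₂ lam β γ).hamiltonian N y) ^ 2 := by
  have h := pinnedChain_hamiltonian_nonneg hω.le hl hβ.le γ N y
  nlinarith

/-- **The witnessed pointwise coherent bound.** For `F ∈ C_c(Ω)`, `s > 0`, `u = K_s F`, a `C¹` observable `g` of the
positions with `|g| ≤ C_g (1+H)` and `∫ g dμ_T = 0`, and the two bath momenta `p_0`, `p_{N-1}`:
`(∫g²)·[(∫ p_0 u)² + (∫ p_{N-1} u)²] + (∫ p_0 g u)² ≤ (∫g²)·T²·[∫(∂_{p_0}u)² + ∫(∂_{p_{N-1}}u)²]` (right side as lower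
integrals; Gaussian integration by parts twice — `∫ p_0 (g u) = T ∫ g ∂_{p_0}u` needs no derivative of `g` in `p` —
and the witnessed Jensen inequality). [folklore] -/
theorem witness_pointwise {g : (Fin N → ℝ) → ℝ} (hg : ContDiff ℝ 1 g) {Cg : ℝ}
    (hgb : ∀ z : PhaseSpace N, |g z.1| ≤ Cg * (1 + (pinnedChain ω₂ lam β γ).hamiltonian N z))
    (hg0 : ∫ z, g z.1 ∂((pinnedChain ω₂ lam β γ).gibbsMeasure N T) = 0)
    {F : PhaseSpace N → ℝ} (hFc : Continuous F) (hFs : HasCompactSupport F) {s : ℝ} (hs : 0 < s) :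
    ENNReal.ofReal ((∫ z, g z.1 ^ 2 ∂((pinnedChain ω₂ lam β γ).gibbsMeasure N T)) *
        ((∫ x, x.2 ⟨0, hN⟩ * (∫ y, F y ∂((pinnedChain ω₂ lam β γ).transitionKernel N T T s.toNNReal x))
            ∂((pinnedChain ω₂ lam β γ).gibbsMeasure N T)) ^ 2 +
          (∫ x, x.2 ⟨N - 1, Nat.sub_lt hN one_pos⟩ *
            (∫ y, F y ∂((pinnedChain ω₂ lam β γ).transitionKernel N T T s.toNNReal x))
            ∂((pinnedChain ω₂ lam β γ).gibbsMeasure N T)) ^ 2) +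
        (∫ x, (x.2 ⟨0, hN⟩ * g x.1) * (∫ y, F y ∂((pinnedChain ω₂ lam β γ).transitionKernel N T T s.toNNReal x))
            ∂((pinnedChain ω₂ lam β γ).gibbsMeasure N T)) ^ 2) ≤
      ENNReal.ofReal (T ^ 2 * ∫ z, g z.1 ^ 2 ∂((pinnedChain ω₂ lam β γ).gibbsMeasure N T)) *
        ((∫⁻ x, ENNReal.ofReal (partialP ⟨0, hN⟩
            (fun z => ∫ y, F y ∂((pinnedChain ω₂ lam β γ).transitionKernel N T T s.toNNReal z)) x ^ 2)
            ∂((pinnedChain ω₂ lam β γ).gibbsMeasure N T)) +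
          ∫⁻ x, ENNReal.ofReal (partialP ⟨N - 1, Nat.sub_lt hN one_pos⟩
            (fun z => ∫ y, F y ∂((pinnedChain ω₂ lam β γ).transitionKernel N T T s.toNNReal z)) x ^ 2)
            ∂((pinnedChain ω₂ lam β γ).gibbsMeasure N T)) := by
  set P := pinnedChain ω₂ lam β γ with hP
  set μ := P.gibbsMeasure N T with hμ
  haveI : IsProbabilityMeasure μ := pinnedChain_isProbabilityMeasure_gibbsMeasure hω hl hβ.le γ N hT
  haveI hMK : ∀ t, IsMarkovKernel (P.transitionKernel N T T t) := fun t =>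
    pinnedChain_isMarkovKernel_transitionKernel hω hl hβ.le hγ.le N T T t
  set j₀ : Fin N := ⟨0, hN⟩ with hj₀
  set jN : Fin N := ⟨N - 1, Nat.sub_lt hN one_pos⟩ with hjN
  set u : PhaseSpace N → ℝ := fun z => ∫ y, F y ∂(P.transitionKernel N T T s.toNNReal z) with hu
  set V : ℝ := ∫ z, g z.1 ^ 2 ∂μ with hV
  set m0 : ℝ := ∫ x, x.2 j₀ * (∫ y, F y ∂(P.transitionKernel N T T s.toNNReal x)) ∂μ with hm0
  set mN : ℝ := ∫ x, x.2 jN * (∫ y, F y ∂(P.transitionKernel N T T s.toNNReal x)) ∂μ with hmN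
  set mw : ℝ := ∫ x, (x.2 j₀ * g x.1) * (∫ y, F y ∂(P.transitionKernel N T T s.toNNReal x)) ∂μ with hmw
  have em0 : m0 = ∫ x, x.2 j₀ * u x ∂μ := rfl
  have emN : mN = ∫ x, x.2 jN * u x ∂μ := rfl
  have emw : mw = ∫ x, (x.2 j₀ * g x.1) * u x ∂μ := rfl
  -- regularity and size of `u`
  have hu2 : ContDiff ℝ 2 u := contDiff_forecast hω hl hγ hN hβ.le hT hT.le hFc hFs hs
  have hud : Differentiable ℝ u := hu2.differentiable two_ne_zero
  have huc : Continuous u := hud.continuous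
  obtain ⟨M, hM⟩ : ∃ M, ∀ x, ‖F x‖ ≤ M := hFc.bounded_above_of_compact_support hFs
  have hM' : ∀ z, |F z| ≤ M := fun z => by rw [← Real.norm_eq_abs]; exact hM z
  have hM0 : 0 ≤ M := (abs_nonneg _).trans (hM' 0)
  have hub : ∀ x, |u x| ≤ M := fun x =>
    (integrable_and_abs_integral_le (ν := P.transitionKernel N T T s.toNNReal x) hFc.measurable hM').2
  have hXc : Continuous (partialP j₀ u) := continuous_partialP hu2 two_ne_zero j₀
  have hYc : Continuous (partialP jN u) := continuous_partialP hu2 two_ne_zero jN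
  -- exponential-moment integrability under `μ`
  have hH0 : ∀ y, 0 ≤ P.hamiltonian N y := fun y => pinnedChain_hamiltonian_nonneg hω.le hl hβ.le γ N y
  set ϑ : ℝ := 1 / (2 * T) with hϑ
  have hϑ0 : 0 < ϑ := by positivity
  have hϑ1 : ϑ < 1 / T := by rw [hϑ, div_lt_div_iff₀ (by positivity) hT]; nlinarith
  have hexpμ := pinnedChain_integrable_exp_mul_hamiltonian_gibbsMeasure hω hl hβ.le γ N hT hϑ1
  set C₀ : ℝ := 2 * Real.exp ϑ / ϑ ^ 2 with hC₀
  have hC₀0 : 0 ≤ C₀ := by positivity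
  have hsq : ∀ y, (1 + P.hamiltonian N y) ^ 2 ≤ C₀ * Real.exp (ϑ * P.hamiltonian N y) := fun y =>
    one_add_sq_le_exp (pinnedChain_hamiltonian_nonneg hω.le hl hβ.le γ _ y) hϑ0
  have hCg0 : 0 ≤ Cg := by
    have h := (abs_nonneg _).trans (hgb 0)
    have h1 : 0 < 1 + P.hamiltonian N 0 := by linarith [hH0 0]
    nlinarith
  have hgc : Continuous fun z : PhaseSpace N => g z.1 := hg.continuous.comp continuous_fst
  -- `g ∈ L²(μ)`, `g ∈ L¹(μ)`
  have hg2i : Integrable (fun z => g z.1 ^ 2) μ := by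
    refine integrable_of_abs_le_exp hexpμ (hgc.pow 2) (C := Cg ^ 2 * C₀) fun y => ?_
    rw [abs_of_nonneg (sq_nonneg _)]
    calc g y.1 ^ 2 = |g y.1| ^ 2 := (sq_abs _).symm
      _ ≤ (Cg * (1 + P.hamiltonian N y)) ^ 2 := pow_le_pow_left₀ (abs_nonneg _) (hgb y) 2
      _ = Cg ^ 2 * (1 + P.hamiltonian N y) ^ 2 := by ring
      _ ≤ Cg ^ 2 * (C₀ * Real.exp (ϑ * P.hamiltonian N y)) := mul_le_mul_of_nonneg_left (hsq y) (sq_nonneg _)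
      _ = Cg ^ 2 * C₀ * Real.exp (ϑ * P.hamiltonian N y) := by ring
  have hg1i : Integrable (fun z => g z.1) μ := by
    refine integrable_of_abs_le_exp hexpμ hgc (C := Cg * C₀) fun y => ?_
    calc |g y.1| ≤ Cg * (1 + P.hamiltonian N y) := hgb y
      _ ≤ Cg * (1 + P.hamiltonian N y) ^ 2 := mul_le_mul_of_nonneg_left (witness_one_add_le_sq hω hl hβ y) hCg0
      _ ≤ Cg * (C₀ * Real.exp (ϑ * P.hamiltonian N y)) := mul_le_mul_of_nonneg_left (hsq y) hCg0
      _ = Cg * C₀ * Real.exp (ϑ * P.hamiltonian N y) := by ring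
  -- degenerate witness: `V = 0` forces `g = 0` a.e. and the witness term vanishes
  have hV0 : 0 ≤ V := integral_nonneg fun z => sq_nonneg _
  by_cases hVz : V = 0
  · have hg0ae : (fun z => g z.1 ^ 2) =ᵐ[μ] 0 := (integral_eq_zero_iff_of_nonneg (fun z => sq_nonneg _) hg2i).1 hVz
    have hw : mw = 0 := by
      rw [emw]
      refine integral_eq_zero_of_ae ?_
      filter_upwards [hg0ae] with z hz
      have : g z.1 = 0 := by simpa using hz
      simp [this]
    rw [hVz, hw]
    simp
  have hVpos : 0 < V := lt_of_le_of_ne hV0 (Ne.symm hVz)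
  -- if a gradient is not square-integrable the right-hand side is infinite
  by_cases hfinX : ∫⁻ x, ENNReal.ofReal (partialP j₀ u x ^ 2) ∂μ = ⊤
  · rw [hfinX, top_add, ENNReal.mul_top (ENNReal.ofReal_pos.2 (by positivity)).ne']
    exact le_top
  by_cases hfinY : ∫⁻ x, ENNReal.ofReal (partialP jN u x ^ 2) ∂μ = ⊤
  · rw [hfinY, add_top, ENNReal.mul_top (ENNReal.ofReal_pos.2 (by positivity)).ne']
    exact le_top
  obtain ⟨hX2, hX1⟩ := integrable_sq_of_lintegral_lt_top hXc (lt_top_iff_ne_top.2 hfinX)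
  obtain ⟨hY2, hY1⟩ := integrable_sq_of_lintegral_lt_top hYc (lt_top_iff_ne_top.2 hfinY)
  -- the three integrations by parts
  have hibp0 := integral_snd_mul_eq_integral_partialP hω hl hβ hT j₀ hud hub hX1
  have hibpN := integral_snd_mul_eq_integral_partialP hω hl hβ hT jN hud hub hY1
  set w : PhaseSpace N → ℝ := fun z => g z.1 * u z with hw
  have hwd : Differentiable ℝ w := (hg.differentiable one_ne_zero).comp differentiable_fst |>.mul hud
  have hdw : partialP j₀ w = fun z => g z.1 * partialP j₀ u z := by
    funext z
    have ew : w = (g ∘ Prod.fst : PhaseSpace N → ℝ) * u := by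
      funext y; rw [hw]; simp [Pi.mul_apply, Function.comp_apply]
    rw [ew, partialP_mul ((hg.differentiable one_ne_zero).comp differentiable_fst) hud, partialP_comp_fst g j₀ z]
    simp [Function.comp_apply]
  have hw1 : Integrable w μ := by
    refine integrable_of_abs_le_exp hexpμ (hgc.mul huc) (C := Cg * M * C₀) fun y => ?_
    rw [hw]; dsimp only
    rw [abs_mul]
    calc |g y.1| * |u y| ≤ (Cg * (1 + P.hamiltonian N y)) * M :=
          mul_le_mul (hgb y) (hub y) (abs_nonneg _) (mul_nonneg hCg0 (by linarith [hH0 y]))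
      _ ≤ (Cg * (1 + P.hamiltonian N y) ^ 2) * M := by
          refine mul_le_mul_of_nonneg_right (mul_le_mul_of_nonneg_left (witness_one_add_le_sq hω hl hβ y) hCg0) hM0
      _ ≤ (Cg * (C₀ * Real.exp (ϑ * P.hamiltonian N y))) * M := by
          refine mul_le_mul_of_nonneg_right (mul_le_mul_of_nonneg_left (hsq y) hCg0) hM0
      _ = Cg * M * C₀ * Real.exp (ϑ * P.hamiltonian N y) := by ring
  have hpw : Integrable (fun x => x.2 j₀ * w x) μ := by
    refine integrable_of_abs_le_exp hexpμ ((by fun_prop : Continuous fun x : PhaseSpace N => x.2 j₀).mul (hgc.mul huc))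
      (C := Cg * M * C₀) fun y => ?_
    rw [hw]; dsimp only
    rw [abs_mul, abs_mul]
    have hp : |y.2 j₀| ≤ 1 + P.hamiltonian N y := MeanFieldDuhamel.abs_snd_le hl hβ.le γ hω.le y j₀
    calc |y.2 j₀| * (|g y.1| * |u y|) ≤ (1 + P.hamiltonian N y) * ((Cg * (1 + P.hamiltonian N y)) * M) :=
          mul_le_mul hp (mul_le_mul (hgb y) (hub y) (abs_nonneg _) (mul_nonneg hCg0 (by linarith [hH0 y])))
            (by positivity) (by linarith [hH0 y])
      _ = Cg * M * (1 + P.hamiltonian N y) ^ 2 := by ring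
      _ ≤ Cg * M * (C₀ * Real.exp (ϑ * P.hamiltonian N y)) := mul_le_mul_of_nonneg_left (hsq y) (by positivity)
      _ = Cg * M * C₀ * Real.exp (ϑ * P.hamiltonian N y) := by ring
  have hgX : Integrable (fun z => g z.1 * partialP j₀ u z) μ := by
    have hsum : Integrable (fun z => (g z.1 ^ 2 + partialP j₀ u z ^ 2) / 2) μ := (hg2i.add hX2).div_const 2
    refine hsum.mono' (hgc.mul hXc).aestronglyMeasurable (Eventually.of_forall fun z => ?_)
    rw [Real.norm_eq_abs, abs_mul]
    nlinarith [sq_nonneg (|g z.1| - |partialP j₀ u z|), sq_abs (g z.1), sq_abs (partialP j₀ u z)]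
  have hdw1 : Integrable (partialP j₀ w) μ := by rw [hdw]; exact hgX
  have hibpW := witness_integral_snd_mul_eq hω hl hβ hT j₀ hwd hw1 hpw hdw1
  rw [hdw] at hibpW
  -- the witnessed Jensen inequality for `X = ∂_{p_0} u`, `φ = g`
  have hWJ := witness_sq_integral_add_sq_le (κ := μ) hX1 hX2 hg1i hg2i hgX hg0
  have hJN := sq_integral_le_integral_sq hY1 hY2
  -- assemble the real inequality
  have hreal : V * (m0 ^ 2 + mN ^ 2) + mw ^ 2 ≤
      (T ^ 2 * V) * ((∫ x, partialP j₀ u x ^ 2 ∂μ) + ∫ x, partialP jN u x ^ 2 ∂μ) := by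
    have e3 : mw = ∫ x, x.2 j₀ * w x ∂μ := by
      rw [emw]
      refine integral_congr_ae (ae_of_all _ fun x => ?_)
      rw [hw]; dsimp only; ring
    rw [em0, emN, hibp0, hibpN, e3, hibpW]
    have hT2 : 0 ≤ T ^ 2 := sq_nonneg T
    nlinarith [mul_le_mul_of_nonneg_left hWJ hT2, mul_le_mul_of_nonneg_left hJN (mul_nonneg hT2 hV0)]
  -- back to `ℝ≥0∞`
  have hRHS : ENNReal.ofReal (T ^ 2 * V) * ((∫⁻ x, ENNReal.ofReal (partialP j₀ u x ^ 2) ∂μ) +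
      ∫⁻ x, ENNReal.ofReal (partialP jN u x ^ 2) ∂μ) =
      ENNReal.ofReal ((T ^ 2 * V) * ((∫ x, partialP j₀ u x ^ 2 ∂μ) + ∫ x, partialP jN u x ^ 2 ∂μ)) := by
    rw [← ofReal_integral_eq_lintegral_ofReal hX2 (ae_of_all _ fun x => sq_nonneg _),
      ← ofReal_integral_eq_lintegral_ofReal hY2 (ae_of_all _ fun x => sq_nonneg _),
      ← ENNReal.ofReal_add (integral_nonneg fun x => sq_nonneg _) (integral_nonneg fun x => sq_nonneg _),
      ← ENNReal.ofReal_mul (by positivity)]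
  rw [hRHS]
  exact ENNReal.ofReal_le_ofReal hreal


end Chain

/-- **Registered form of the witnessed pointwise coherent bound** (stub `sa_witnessPointwise`; closed statement of
`witness_pointwise`). [folklore] -/
theorem sa_witnessPointwise :
    ∀ ω₂ lam β γ : ℝ, 0 < ω₂ → 0 ≤ lam → 0 < β → 0 < γ → ∀ T : ℝ, 0 < T → ∀ (N : ℕ) (hN : 0 < N) (g : (Fin N → ℝ) → ℝ) (Cg : ℝ) (F : PhaseSpace N → ℝ) (s : ℝ), ContDiff ℝ 1 g → (∀ z : PhaseSpace N, |g z.1| ≤ Cg * (1 + (pinnedChain ω₂ lam β γ).hamiltonian N z)) → ∫ z, g z.1 ∂((pinnedChain ω₂ lam β γ).gibbsMeasure N T) = 0 → Continuous F → HasCompactSupport F → 0 < s → ENNReal.ofReal ((∫ z, g z.1 ^ 2 ∂((pinnedChain ω₂ lam β γ).gibbsMeasure N T)) * ((∫ x, x.2 ⟨0, hN⟩ * (∫ y, F y ∂((pinnedChain ω₂ lam β γ).transitionKernel N T T s.toNNReal x)) ∂((pinnedChain ω₂ lam β γ).gibbsMeasure N T)) ^ 2 + (∫ x, x.2 ⟨N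 - 1, Nat.sub_lt hN one_pos⟩ * (∫ y, F y ∂((pinnedChain ω₂ lam β γ).transitionKernel N T T s.toNNReal x)) ∂((pinnedChain ω₂ lam β γ).gibbsMeasure N T)) ^ 2) + (∫ x, (x.2 ⟨0, hN⟩ * g x.1) * (∫ y, F y ∂((pinnedChain ω₂ lam β γ).transitionKernel N T T s.toNNReal x)) ∂((pinnedChain ω₂ lam β γ).gibbsMeasure N T)) ^ 2) ≤ ENNReal.ofReal (T ^ 2 * ∫ z, g z.1 ^ 2 ∂((pinnedChain ω₂ lam β γ).gibbsMeasure N T)) * ((∫⁻ x, ENNReal.ofReal (partialP ⟨0, hN⟩ (fun z => ∫ y, F y ∂((pinnedChain ω₂ lam β γ).transitionKernel N T T s.toNNReal z)) x ^ 2) ∂((pinnedChain ω₂ lam β γ).gibbsMeasure N T)) + ∫⁻ x, ENNReal.ofReal (partialP ⟨N - 1, Nat.sub_lt hN one_pos⟩ (fun z => ∫ y, F y ∂((pinnedChain ω₂ lam β γ).transitionKernel N T T s.toNNReal z)) x ^ 2) ∂((pinnedChain ω₂ lam β γ).gibbsMeasure N T)) :=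
  fun _ _ _ _ hω hl hβ hγ _ hT _ hN _ _ _ _ hg hgb hg0 hFc hFs hs =>
    witness_pointwise hω hl hβ hγ hN hT hg hgb hg0 hFc hFs hs

end Summit.AtomisticToContinuum.FouriersLaw.Theorems.CoherentDephasing.StrictAbsorption

end
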